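import Summits.Schanuel.Schanuel.Theorems.SoloInformedModularDoor
import Summits.Schanuel.Schanuel.Theorems.SoloInformedModularDoorRungs
import Literature.NumberTheory.Transcendental.OneMotiveToric

/-!
# Door (M), part 3: the quasi-modular conjecture at level one as a named hypothesis

Soloist file (`solo-Schanuel-informed`, 2026-08-19, s8), part 3 of 3 (part 1
`SoloInformedModularDoor`: identities at `τ₀ = i/π`, unconditional floor; part 2
`SoloInformedModularDoorRungs`: bookkeeping from the point hypotheses `FourAt`, `FiveAt`).
Here the two conjectures in print are DEFINED / imported as `Prop`s and instantiated at the two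
points `i/π` and `iπ = S(i/π)` of one `SL₂(ℤ)`-orbit; `P, Q, R` = Ramanujan's functions at `e^{−2}`.

* `QuasiModularFiveConjecture` (OPEN; [cite: Fonseca2020, Conjecture 4.8], the non-CM clause
  "`trdeg ℚ(2πi, τ, q, E₂, E₄, E₆) ≥ 5`"; the elliptico-toric case of [cite: Bertolin2002], cf.
  [cite: Waldschmidt2004, §3]). It implies Nesterenko's Conjecture 1.11 in the corrected form of
  the tree (`nesterenkoConjecture_corrected_of_quasiModularFive`; the verbatim
  `NesterenkoConjecture_1_11` is false in Lean, see `NesterenkoModularScopeConjecture`).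
* At `i/π`: `QuasiModularFive ⟹ π, e^{−2}, P, Q, R` algebraically independent ⟹ **`e ⟂ π`**
  (`expOnePi_of_quasiModularFive`) ⟹ R1 (`twoOfEPiExpPiSq_of_quasiModularFive`);
  `Conjecture 1.11 ⟹ 4 ≤ trdeg ℚ(π, e, P, Q, R)` and the dichotomy
  (`algebraicIndependent_PQR_of_nesterenkoConjecture`), but not `e ⟂ π`.
* At `iπ`: `QuasiModularFive ⟹ π, e^{−2π²}, P, Q, R` algebraically independent ⟹ `π ⟂ e^{π²}`
  (`algebraicIndependent_pi_expPiSq_of_quasiModularFive`).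
* The `F₆`-ladder, `F₆ = ℚ(e, π, e^{π²}, P, Q, R)` (`modularSix`): `3 ≤ trdeg F₆` PROVED
  (part 1); `FourOfSix` OPEN ⟸ Conjecture 1.11, incomparable with R1 = `TwoOfEPiExpPiSq`;
  `FiveOfSix` OPEN ⟸ `QuasiModularFive`, and `FiveOfSix ⟹ R1`; `trdeg F₆ = 6 ⟸` Schanuel for
  `(1, iπ, π²)` + algebraic independence of `P, Q, R` over `ℚ(e, π, e^{π²})` (not typed here).
Honest status: a typed door, not an engine — Nesterenko's method sees `K`-functions of `q`
only, and `τ = log q / (2πi)`, `2πi` are outside it ("seems out of reach", Fonseca loc. cit.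
p. 13; barrier `NesterenkoModularScope`).
-/

noncomputable section

open Complex IntermediateField
open scoped Real
open Literature.NumberTheory.Transcendental (ExpOnePiAlgebraicIndependent trdeg_adjoin_insert_le)
open Literature.Barriers.Schanuel (ramanujanP ramanujanQ ramanujanR
  NesterenkoConjecture_1_11_corrected trdeg_mono trdeg_adjoin_union_eq_of_isAlgebraic
  algebraicIndependent_of_le_trdeg_adjoin isAlgebraic_I)

namespace Summit.Schanuel.Schanuel.Theorems

/-! ### §1 The conjecture -/

/-- **The quasi-modular conjecture with `2πi` adjoined (non-CM lower bound).** For `τ ∈ ℍ` not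
imaginary quadratic, `trdeg ℚ(2πi, τ, e^{2πiτ}, P(e^{2πiτ}), Q(e^{2πiτ}), R(e^{2πiτ})) ≥ 5`.
[cite: Fonseca2020, Conjecture 4.8] (arXiv:2011.14401 p. 13: "≥ 3, = 3 if `τ` is CM, ≥ 5
otherwise"; the CM clause is Nesterenko's theorem and is omitted here); the elliptico-toric
special case of the conjecture of [cite: Bertolin2002], cf. [cite: Waldschmidt2004, §3].
OPEN — "a proof … seems out of reach" (Fonseca, loc. cit.). A consequence of Grothendieck's period
conjecture for the 1-motives `[ℤ → E × 𝔾_m]`; neither implied by nor implying Schanuel's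
conjecture. -/
@[conjecture] def QuasiModularFiveConjecture : Prop :=
  ∀ τ : ℂ, 0 < τ.im → (¬ ∃ b c : ℚ, τ ^ 2 + (b : ℂ) * τ + (c : ℂ) = 0) →
    (5 : Cardinal) ≤ Algebra.trdeg ℚ ↥(adjoin ℚ ({2 * (π : ℂ) * I, τ, cexp (2 * π * I * τ),
      ramanujanP (cexp (2 * π * I * τ)), ramanujanQ (cexp (2 * π * I * τ)),
      ramanujanR (cexp (2 * π * I * τ))} : Set ℂ))

/-- Cardinal bookkeeping: `¬ (t ≤ 3) → 4 ≤ t`. -/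
theorem four_le_of_not_le_three_door {t : Cardinal} (h : ¬ t ≤ 3) : 4 ≤ t := by
  have h3 : (3 : Cardinal) < t := not_le.mp h
  calc (4 : Cardinal) = 3 + 1 := by norm_num
    _ ≤ t := Cardinal.add_one_le_of_lt h3

/-- Cardinal bookkeeping: `5 ≤ a + 1` with `a ≤ 3` is absurd. -/
theorem not_five_le_add_one_door {a : Cardinal} (h5 : 5 ≤ a + 1) (ha : a ≤ 3) : False := by
  obtain ⟨m, rfl⟩ := Cardinal.lt_aleph0.mp (ha.trans_lt (Cardinal.natCast_lt_aleph0 (n := 3)))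
  norm_cast at h5 ha
  omega

/-- **The quasi-modular conjecture implies Nesterenko's Conjecture 1.11 (corrected form)**:
dropping the generator `2πi` costs at most one in transcendence degree. (This implication is the
file's remark; [cite: Fonseca2020, Exercise 4.9] records that Conjecture 4.8 implies Nesterenko's
and Schneider's THEOREMS.) -/
theorem nesterenkoConjecture_corrected_of_quasiModularFive (h : QuasiModularFiveConjecture) :
    NesterenkoConjecture_1_11_corrected := by
  intro τ hτ hle
  by_contra hnq
  have h5 := h τ hτ hnq
  have hle' := trdeg_adjoin_insert_le ({τ, cexp (2 * π * I * τ),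
      ramanujanP (cexp (2 * π * I * τ)), ramanujanQ (cexp (2 * π * I * τ)),
      ramanujanR (cexp (2 * π * I * τ))} : Set ℂ) (2 * (π : ℂ) * I)
  exact not_five_le_add_one_door (h5.trans hle') hle

/-! ### §2 Instantiation at `τ₀ = i/π` and at `S τ₀ = iπ` -/

/-- **Conjecture 1.11 (corrected) ⟹ `FourAt`**: `4 ≤ trdeg ℚ(i/π, e^{−2}, P, Q, R)`, because
`i/π` is not imaginary quadratic (part 1, `not_quadratic_I_div_pi`). -/
theorem fourAt_of_nesterenkoConjecture (h : NesterenkoConjecture_1_11_corrected) :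
    (4 : Cardinal) ≤ Algebra.trdeg ℚ ↥(adjoin ℚ ({I / (π : ℂ), cexp (-2),
      ramanujanP (cexp (-2)), ramanujanQ (cexp (-2)), ramanujanR (cexp (-2))} : Set ℂ)) := by
  have h4 : (4 : Cardinal) ≤ Algebra.trdeg ℚ ↥(adjoin ℚ ({I / (π : ℂ), cexp (2 * π * I * (I / π)),
      ramanujanP (cexp (2 * π * I * (I / π))), ramanujanQ (cexp (2 * π * I * (I / π))),
      ramanujanR (cexp (2 * π * I * (I / π)))} : Set ℂ)) :=
    four_le_of_not_le_three_door fun hle => not_quadratic_I_div_pi (h (I / π) im_I_div_pi_pos hle)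
  rwa [two_pi_I_mul_I_div_pi] at h4

/-- **`QuasiModularFive ⟹ FiveAt`**: `5 ≤ trdeg ℚ(2πi, i/π, e^{−2}, P, Q, R)`. -/
theorem fiveAt_of_quasiModularFive (h : QuasiModularFiveConjecture) :
    (5 : Cardinal) ≤ Algebra.trdeg ℚ ↥(adjoin ℚ ({2 * (π : ℂ) * I, I / π, cexp (-2),
      ramanujanP (cexp (-2)), ramanujanQ (cexp (-2)), ramanujanR (cexp (-2))} : Set ℂ)) := by
  have h5 := h (I / π) im_I_div_pi_pos not_quadratic_I_div_pi
  have hset : ({2 * (π : ℂ) * I, I / π, cexp (2 * π * I * (I / π)),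
      ramanujanP (cexp (2 * π * I * (I / π))), ramanujanQ (cexp (2 * π * I * (I / π))),
      ramanujanR (cexp (2 * π * I * (I / π)))} : Set ℂ) =
      {2 * (π : ℂ) * I, I / π, cexp (-2), ramanujanP (cexp (-2)), ramanujanQ (cexp (-2)),
        ramanujanR (cexp (-2))} := by
    rw [two_pi_I_mul_I_div_pi]
  exact h5.trans_eq (equivOfEq (F := ℚ) (E := ℂ) (congrArg (adjoin ℚ) hset)).trdeg_eq

/-- **`QuasiModularFive` at the dual point `iπ` ⟹ `π, e^{−2π²}, P(e^{−2}), Q(e^{−2}), R(e^{−2})`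
algebraically independent** (the values at `e^{−2π²}` pulled back by the identities of part 1). -/
theorem algebraicIndependent_five_dual_of_quasiModularFive (h : QuasiModularFiveConjecture) :
    AlgebraicIndependent ℚ ![(π : ℂ), cexp (-(2 * (π : ℂ) ^ 2)), ramanujanP (cexp (-2)),
      ramanujanQ (cexp (-2)), ramanujanR (cexp (-2))] := by
  have hτ : 0 < ((π : ℂ) * I).im := by simp [Real.pi_pos]
  have h5τ := h ((π : ℂ) * I) hτ not_quadratic_pi_mul_I
  have hset : ({2 * (π : ℂ) * I, π * I, cexp (2 * π * I * (π * I)),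
      ramanujanP (cexp (2 * π * I * (π * I))), ramanujanQ (cexp (2 * π * I * (π * I))),
      ramanujanR (cexp (2 * π * I * (π * I)))} : Set ℂ) =
      {2 * (π : ℂ) * I, π * I, cexp (-(2 * (π : ℂ) ^ 2)),
        ramanujanP (cexp (-(2 * (π : ℂ) ^ 2))), ramanujanQ (cexp (-(2 * (π : ℂ) ^ 2))),
        ramanujanR (cexp (-(2 * (π : ℂ) ^ 2)))} := by
    rw [two_pi_I_mul_pi_mul_I]
  have h5 := h5τ.trans_eq (equivOfEq (F := ℚ) (E := ℂ) (congrArg (adjoin ℚ) hset)).trdeg_eq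
  set v : Fin 5 → ℂ := ![(π : ℂ), cexp (-(2 * (π : ℂ) ^ 2)), ramanujanP (cexp (-2)),
      ramanujanQ (cexp (-2)), ramanujanR (cexp (-2))] with hv
  set F : IntermediateField ℚ ℂ := adjoin ℚ (Set.range v ∪ {I}) with hF
  have hpi : (π : ℂ) ∈ F := subset_adjoin ℚ _ (Or.inl ⟨0, rfl⟩)
  have hq : cexp (-(2 * (π : ℂ) ^ 2)) ∈ F := subset_adjoin ℚ _ (Or.inl ⟨1, rfl⟩)
  have hP : ramanujanP (cexp (-2)) ∈ F := subset_adjoin ℚ _ (Or.inl ⟨2, rfl⟩)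
  have hQ : ramanujanQ (cexp (-2)) ∈ F := subset_adjoin ℚ _ (Or.inl ⟨3, rfl⟩)
  have hR : ramanujanR (cexp (-2)) ∈ F := subset_adjoin ℚ _ (Or.inl ⟨4, rfl⟩)
  have hI : I ∈ F := subset_adjoin ℚ _ (Or.inr rfl)
  have h2 : (2 : ℂ) ∈ F := by exact_mod_cast IntermediateField.natCast_mem F 2
  have h6 : (6 : ℂ) ∈ F := by exact_mod_cast IntermediateField.natCast_mem F 6
  have hle : adjoin ℚ ({2 * (π : ℂ) * I, π * I, cexp (-(2 * (π : ℂ) ^ 2)),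
      ramanujanP (cexp (-(2 * (π : ℂ) ^ 2))), ramanujanQ (cexp (-(2 * (π : ℂ) ^ 2))),
      ramanujanR (cexp (-(2 * (π : ℂ) ^ 2)))} : Set ℂ) ≤ F := by
    rw [adjoin_le_iff]
    intro w hw
    simp only [Set.mem_insert_iff, Set.mem_singleton_iff] at hw
    rcases hw with rfl | rfl | rfl | rfl | rfl | rfl
    · exact mul_mem (mul_mem h2 hpi) hI
    · exact mul_mem hpi hI
    · exact hq
    · rw [ramanujanP_exp_neg_two_pi_sq]; exact div_mem (sub_mem h6 hP) (pow_mem hpi 2)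
    · rw [ramanujanQ_exp_neg_two_pi_sq]; exact div_mem hQ (pow_mem hpi 4)
    · rw [ramanujanR_exp_neg_two_pi_sq]; exact div_mem (neg_mem hR) (pow_mem hpi 6)
  have hIalg : ∀ t ∈ ({I} : Set ℂ), IsAlgebraic ℚ t := by
    intro t ht; rw [Set.mem_singleton_iff.mp ht]; exact isAlgebraic_I
  have h5' : (5 : Cardinal) ≤ Algebra.trdeg ℚ ↥(adjoin ℚ (Set.range v)) :=
    (h5.trans (trdeg_mono hle)).trans_eq (trdeg_adjoin_union_eq_of_isAlgebraic _ {I} hIalg)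
  exact algebraicIndependent_of_le_trdeg_adjoin _ (by exact_mod_cast h5')

/-! ### §3 The consequences for `e` and `π` -/

/-- **Conjecture 1.11 ⟹ 4 ≤ trdeg ℚ(π, e, P(e^{−2}), Q(e^{−2}), R(e^{−2}))**. -/
theorem four_le_trdeg_pi_e_PQR_of_nesterenkoConjecture (h : NesterenkoConjecture_1_11_corrected) :
    (4 : Cardinal) ≤ Algebra.trdeg ℚ ↥(adjoin ℚ ({(π : ℂ), cexp 1,
      ramanujanP (cexp (-2)), ramanujanQ (cexp (-2)), ramanujanR (cexp (-2))} : Set ℂ)) :=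
  four_le_trdeg_pi_e_PQR_of_fourAt (fourAt_of_nesterenkoConjecture h)

/-- **Conjecture 1.11 ⟹ (`e, π` algebraically dependent ⟹ `P, Q, R` algebraically
independent at `e^{−2}`)** — the dichotomy; Conjecture 1.11 does NOT give `e ⟂ π`. -/
theorem algebraicIndependent_PQR_of_nesterenkoConjecture (h : NesterenkoConjecture_1_11_corrected)
    (hdep : ¬ ExpOnePiAlgebraicIndependent) :
    AlgebraicIndependent ℚ ![ramanujanP (cexp (-2)), ramanujanQ (cexp (-2)),
      ramanujanR (cexp (-2))] :=
  algebraicIndependent_PQR_of_fourAt (fourAt_of_nesterenkoConjecture h) hdep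

/-- **`QuasiModularFive ⟹ π, e^{−2}, P, Q, R` algebraically independent.** -/
theorem algebraicIndependent_five_of_quasiModularFive (h : QuasiModularFiveConjecture) :
    AlgebraicIndependent ℚ ![(π : ℂ), cexp (-2), ramanujanP (cexp (-2)), ramanujanQ (cexp (-2)),
      ramanujanR (cexp (-2))] :=
  algebraicIndependent_five_of_fiveAt (fiveAt_of_quasiModularFive h)

/-- **`QuasiModularFive ⟹ e ⟂ π`** — the quasi-modular conjecture at the single non-CM point
`i/π` implies the algebraic independence of `e` and `π`. -/
theorem expOnePi_of_quasiModularFive (h : QuasiModularFiveConjecture) :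
    ExpOnePiAlgebraicIndependent :=
  expOnePi_of_fiveAt (fiveAt_of_quasiModularFive h)

/-- **`QuasiModularFive ⟹ R1`** (`TwoOfEPiExpPiSq`, the first open rung at `(1, πi)`). -/
theorem twoOfEPiExpPiSq_of_quasiModularFive (h : QuasiModularFiveConjecture) : TwoOfEPiExpPiSq :=
  twoOfEPiExpPiSq_of_fiveAt (fiveAt_of_quasiModularFive h)

/-- **`QuasiModularFive ⟹ π ⟂ e^{π²}`** (from the dual point `iπ`; printed open,
[cite: BakerTNT1975, Ch. 12 §1 p. 119]). -/
theorem algebraicIndependent_pi_expPiSq_of_quasiModularFive (h : QuasiModularFiveConjecture) :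
    AlgebraicIndependent ℚ ![Real.pi, Real.exp (Real.pi ^ 2)] :=
  algebraicIndependent_pi_expPiSq_of_dual (algebraicIndependent_five_dual_of_quasiModularFive h)

/-! ### §4 The `F₆`-ladder: `F₆ = ℚ(e, π, e^{π²}, P(e^{−2}), Q(e^{−2}), R(e^{−2}))` -/

/-- The six generators `e, π, e^{π²}, P(e^{−2}), Q(e^{−2}), R(e^{−2})`: a field containing
Nesterenko's quadruple at both nomes `e^{−2}`, `e^{−2π²}` and the R1 triple `e, π, e^{π²}`. -/
def modularSix : Set ℂ := {cexp 1, (π : ℂ), cexp ((π : ℂ) ^ 2),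
  ramanujanP (cexp (-2)), ramanujanQ (cexp (-2)), ramanujanR (cexp (-2))}

/-- Unfolding `modularSix`. -/
theorem modularSix_def : modularSix = {cexp 1, (π : ℂ), cexp ((π : ℂ) ^ 2),
    ramanujanP (cexp (-2)), ramanujanQ (cexp (-2)), ramanujanR (cexp (-2))} := rfl

/-- **Rung `FourOfSix`** (OPEN): `4 ≤ trdeg F₆`. Implied by Conjecture 1.11; incomparable with R1
by bookkeeping. -/
@[conjecture] def FourOfSix : Prop := (4 : Cardinal) ≤ Algebra.trdeg ℚ ↥(adjoin ℚ modularSix)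

/-- **Rung `FiveOfSix`** (OPEN): `5 ≤ trdeg F₆`. Implied by `QuasiModularFive`; implies R1. -/
@[conjecture] def FiveOfSix : Prop := (5 : Cardinal) ≤ Algebra.trdeg ℚ ↥(adjoin ℚ modularSix)

/-- The floor of the ladder, PROVED (part 1): `3 ≤ trdeg F₆`. -/
theorem three_le_trdeg_modularSix : (3 : Cardinal) ≤ Algebra.trdeg ℚ ↥(adjoin ℚ modularSix) :=
  three_le_trdeg_six

/-- `FiveOfSix ⟹ FourOfSix`. -/
theorem fourOfSix_of_fiveOfSix (h : FiveOfSix) : FourOfSix :=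
  le_trans (by norm_num) h

/-- **Conjecture 1.11 ⟹ `FourOfSix`.** -/
theorem fourOfSix_of_nesterenkoConjecture (h : NesterenkoConjecture_1_11_corrected) : FourOfSix :=
  four_le_trdeg_six_of_fourAt (fourAt_of_nesterenkoConjecture h)

/-- **`QuasiModularFive ⟹ FiveOfSix`.** -/
theorem fiveOfSix_of_quasiModularFive (h : QuasiModularFiveConjecture) : FiveOfSix :=
  five_le_trdeg_six_of_fiveAt (fiveAt_of_quasiModularFive h)

/-- **`FiveOfSix ⟹ R1`** (`TwoOfEPiExpPiSq`). -/
theorem twoOfEPiExpPiSq_of_fiveOfSix (h : FiveOfSix) : TwoOfEPiExpPiSq :=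
  twoOfEPiExpPiSq_of_five_le_trdeg_six h

end Summit.Schanuel.Schanuel.Theorems
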